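import Summits.AtomisticToContinuum.Crystallization.Theorems.FrustratedLawDichotomyCellHaloNormal

/-!
# Class-Z K-file helpers (lens-5 g114, after census ZT2F1-57): the SHARP label-wise radial bracket and the INTERVAL witness recipe

Discharge lemmas for the hypotheses of `…CellZFloorFrame.rowFloorZ₁/₂_of_tables'` (`hrbr`) and of
`…CellZFrame.halfCrystal_mem_cellRowZ` (`hsf`); tree imports only, independent of (373)/(374).

* `norm_posL_sharp_bracket` — census ZT2F1-57 §2 («RADIAL BRACKET»): for `|FᵀF − 1| ≤ ε` entrywise,
  `r_lo ≤ ‖F v‖ ≤ r_hi` from the two label-wise table facts `r_lo² ≤ Σ vᵢ² − ε (Σ|vᵢ|)²` and `Σ vᵢ² + ε (Σ|vᵢ|)² ≤ r_hi²`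
  (via `dot_sub_le_gram` / `gram_le_dot_add` at `a = n = v`; sharper than the `(1 ∓ 3ε)` form of `gram_ge_nearId` by the factor
  `(Σ|vᵢ|)² / (3 Σ vᵢ²) ≤ 1`).
* (LANE EDITION hand-2 g48, GO (389) dedup: the interval / midpoint straddle lemmas of the node are the TREE's
  `…CellZFrame.straddleFree_of_intHeights'` / `straddleFree_of_intHeights` (#118) — dropped here, cite those.)
-/

noncomputable section

namespace Summit.AtomisticToContinuum.Crystallization.Theorems.FrustratedLawDichotomyCellZWitness

open scoped BigOperators
open Summit.AtomisticToContinuum.Crystallization.Theorems.FrustratedLawDichotomyCellMetric (posL gram norm_sq_posL le_norm_posL)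
open Summit.AtomisticToContinuum.Crystallization.Theorems.FrustratedLawDichotomyCellHaloNormal (gram_le_dot_add dot_sub_le_gram)

/-- SHARP RADIAL BRACKET (label-wise): `r_lo ≤ ‖F v‖ ≤ r_hi` from `r_lo² ≤ Σvᵢ² − ε(Σ|vᵢ|)²` and `Σvᵢ² + ε(Σ|vᵢ|)² ≤ r_hi²`.
[folklore] census ZT2F1-57 §2. -/
theorem norm_posL_sharp_bracket {F : Matrix (Fin 3) (Fin 3) ℝ} {ε rlo rhi : ℝ}
    (hG : ∀ i j, |(F.transpose * F) i j - (if i = j then 1 else 0)| ≤ ε) (v : Fin 3 → ℝ) (hrlo : 0 ≤ rlo) (hrhi : 0 ≤ rhi)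
    (hlo : rlo ^ 2 ≤ ∑ i, v i * v i - ε * ((∑ i, |v i|) * ∑ i, |v i|))
    (hhi : ∑ i, v i * v i + ε * ((∑ i, |v i|) * ∑ i, |v i|) ≤ rhi ^ 2) :
    rlo ≤ ‖posL F v‖ ∧ ‖posL F v‖ ≤ rhi := by
  constructor
  · exact le_norm_posL F hrlo (hlo.trans (dot_sub_le_gram hG v v))
  · have h1 := gram_le_dot_add hG v v
    have hsq : ‖posL F v‖ ^ 2 ≤ rhi ^ 2 := by
      rw [norm_sq_posL]
      linarith
    nlinarith [norm_nonneg (posL F v)]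

/-- The same with `Σ vᵢ²` written as squares. [folklore] -/
theorem norm_posL_sharp_bracket' {F : Matrix (Fin 3) (Fin 3) ℝ} {ε rlo rhi : ℝ}
    (hG : ∀ i j, |(F.transpose * F) i j - (if i = j then 1 else 0)| ≤ ε) (v : Fin 3 → ℝ) (hrlo : 0 ≤ rlo) (hrhi : 0 ≤ rhi)
    (hlo : rlo ^ 2 ≤ ∑ i, v i ^ 2 - ε * (∑ i, |v i|) ^ 2) (hhi : ∑ i, v i ^ 2 + ε * (∑ i, |v i|) ^ 2 ≤ rhi ^ 2) :
    rlo ≤ ‖posL F v‖ ∧ ‖posL F v‖ ≤ rhi := by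
  have h1 : ∑ i, v i * v i = ∑ i, v i ^ 2 := Finset.sum_congr rfl fun i _ => (sq (v i)).symm
  have h2 : (∑ i, |v i|) * ∑ i, |v i| = (∑ i, |v i|) ^ 2 := (sq _).symm
  refine norm_posL_sharp_bracket hG v hrlo hrhi ?_ ?_
  · rw [h1, h2]
    exact hlo
  · rw [h1, h2]
    exact hhi

end Summit.AtomisticToContinuum.Crystallization.Theorems.FrustratedLawDichotomyCellZWitness

end
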